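import Summits.Langlands.Langlands.Theorems.ParityBlindBianchiQuadraticDescentGL2UnitaryReduction
import Summits.Langlands.Langlands.Theorems.ParityBlindBianchiQuadraticDescentGL2TwistAsaiDatum
import Summits.Langlands.Langlands.Theorems.ParityBlindBianchiQuadraticDescentGL2TwistedFactors
import Summits.Langlands.Langlands.Theorems.ParityBlindBianchiQuadraticDescentGL2UnitaryAE
import Summits.Langlands.Langlands.Theorems.ParityBlindBianchiQuadraticDescentGL2HolTwisted
import Literature.NumberTheory.Automorphic.TwistedAsaiPole
import Literature.NumberTheory.Automorphic.TwistedAsaiContinuationGLTwo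
import Literature.NumberTheory.Automorphic.PartialAsaiLHolomorphy
import Literature.NumberTheory.GaloisRepresentations.HeckeCharacterExtensionQuadraticGeneralProofs
import HarnessLib

/-!
# Flicker's twisted `GL₂` Asai continuation from the Grbac–Shahidi holomorphy (crux `QuadraticDescentGL2`, line `Sketch`, stub W7)

Helper of the crux `ParityBlindBianchi.QuadraticDescentGL2` (stmt-Langlands-16811), registered stub
`stub_flickerOfHolomorphy` of skeleton v3 (`Cruxes/QuadraticDescentGL2/Lines/Sketch.lean`): the body of the named fact
`Flicker1988_twistedAsaiL_continuation_GL2` (Flicker 1988, Theorem p. 297 with the twist of p. 296, rank 2, near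
`Re s ≥ 1`; `TwistedAsaiContinuationGLTwo`) FOLLOWS from the tree's canonical Asai-continuation named fact
`GrbacShahidi2015_partialAsaiL_holomorphy` (`PartialAsaiLHolomorphy`; `L²` currency, untwisted, both signs), by
theorems of the tree only:

1. `stub_unitaryReduction` (W1, p163724): replace `(P, χ)` by a norm twist `(P₁, χ₁)` with `χ₁` unitary, the same
   Asai-datum shape `(S, A₁)`, ramification, central clause and `χ`-twisted local Asai factors;
2. `HewittRoss_heckeCharacter_extension_quadratic_holds` (PROVED in the tree, Weil's extension principle +
   Dirichlet): a unitary Hecke character `μ` of `E` over `χ₁`, unramified above the complement of `S`;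
3. `stub_twistAsaiDatum` (W3, p163402): the twist `P' = P₁ ⊗ (μ ∘ det)` carries the Asai datum `(S, μ(ϖ) • A₁)`;
4. `stub_unitaryAE` (W5, p163525): `P'` is unitary a.e. (central clause);
5. `stub_holTwisted` (W6, p163478): `CuspidalAutomorphicRepData.hol_of_asaiHolomorphyL2` (Borel–Jacquet/L²
   dictionary, `Re z = 0`) + `exists_multipliable_asaiEulerFactors` give ONE abscissa, ONE radius and, for each
   sign, a continuation of `(s - 1) L^S(s, P', As^θ)` to `{1 < Re s} ∪ B(1, δ)`;
6. `stub_twistedFactors` (W4, p163516): factor by factor, the untwisted Asai factors of `μ(ϖ) • A₁` are the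
   `χ₁`-twisted factors of `A₁`, hence (W1) the `χ`-twisted factors of `A`; so multipliability transfers and
   `L^S(s, P', As^θ) = L^S(s, P, As^θ ⊗ χ)` (`partialAsaiL`, `partialAsaiLTwist` are the same `tprod`).

So the line's analytic debt is the ONE canonical fact `GrbacShahidi2015_partialAsaiL_holomorphy` (whose `As⁺`,
`N = 2` part is on the tree's Flicker road: `AsaiZetaIntegral`, `AsaiUnramifiedTorus`,
`RankinSelbergIntegralEntireBounded`), shared with `Mok2014_partialAsaiL_continuation_pole_dichotomy` and
`GrbacShahidi2015_partialAsaiL_at_one`.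

## References

* Y. Z. Flicker, *Twisted tensors and Euler products*, Bull. Soc. Math. France 116 (1988), 295–313: Theorem p. 297,
  p. 296. [Flicker1988]
* N. Grbac, F. Shahidi, *Endoscopic transfer for unitary groups and holomorphy of Asai `L`-functions*, Pacific J.
  Math. 276 (2015), Thm. 4.3 (1), (2)(a). [GrbacShahidi2015]
* E. Hewitt, K. A. Ross, *Abstract Harmonic Analysis I* (1979), Thm. (24.12). [HewittRoss1979]
* A. Borel, H. Jacquet, *Automorphic forms and automorphic representations*, Corvallis 1979, 5.7.
  [BorelJacquetCorvallis1979]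
-/

set_option linter.dupNamespace false

noncomputable section

namespace Summit.Langlands.Langlands.Theorems.QuadraticDescentGL2.Sketch

open scoped Classical
open Filter Set Function Polynomial
open NumberField IsDedekindDomain
open Literature.NumberTheory.Automorphic Literature.NumberTheory.GaloisRepresentations

/-- **Stub W7 — Flicker 1988 for `GL₂`, twisted, from `GrbacShahidi2015_partialAsaiL_holomorphy`.** The body of the
named fact `Flicker1988_twistedAsaiL_continuation_GL2` (for `E/F` quadratic with involution `c ≠ 1`, a cuspidal `P`
on `GL₂(𝔸_E)`, a Hecke character `χ` of `F`, and an Asai datum `(S, A) ⊇ ram χ` with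
`e₂(A w) χ(ϖ_v)^{f(w|v)} = 1` above `v ∉ S`: multipliability of both twisted partial Asai Euler products beyond some
`σ₀ ≥ 1`, and holomorphic continuation of `(s - 1) L^S(s, P, As^θ ⊗ χ)` to `{1 < Re s} ∪ B(1, δ)` for both signs)
follows from the Grbac–Shahidi holomorphy fact: unitary reduction (W1), Hewitt–Ross extension of `χ₁` to a unitary
`μ` on `E` unramified above the complement of `S` (tree theorem), twist `P' = P₁ ⊗ μ` with Asai datum
`(S, μ(ϖ) • A₁)` (W3), unitary a.e. (W5), analytic package for `P'` (W6), and the factor identity untwisted-of-twist =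
twisted (W4 + W1). [cite: Flicker1988, Theorem p. 297 and p. 296] [cite: GrbacShahidi2015, Thm. 4.3 (1), (2)(a)]
[cite: HewittRoss1979, (24.12)] [cite: BorelJacquetCorvallis1979, 5.7] -/
theorem stub_flickerOfHolomorphy :
    GrbacShahidi2015_partialAsaiL_holomorphy → Flicker1988_twistedAsaiL_continuation_GL2 := by
  intro hGS F E _ _ _ _ _ c h2 hc hE P χ S A hSA hram hcent
  -- W1: unitary reduction
  obtain ⟨P₁, χ₁, A₁, hχ₁u, hSA₁, hram₁, hcent₁, hfac₁⟩ :=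
    stub_unitaryReduction F E c h2 hc hE P χ S A hSA hram hcent
  -- Hewitt–Ross (tree theorem): a unitary extension `μ` of `χ₁` to `E`, unramified above the complement of `S`
  have hadm : ∀ u ∈ {w : HeightOneSpectrum (𝓞 E) | w.under (𝓞 F) ∉ S},
      c • u ∈ {w : HeightOneSpectrum (𝓞 E) | w.under (𝓞 F) ∉ S} → χ₁.IsUnramifiedAt (u.under (𝓞 F)) := by
    intro u hu _
    by_contra hr
    exact hu (hram₁ hr)
  obtain ⟨μ, hμu, hμres, hμunr⟩ :=
    HewittRoss_heckeCharacter_extension_quadratic_holds F E c h2 hc χ₁ hχ₁u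
      {w : HeightOneSpectrum (𝓞 E) | w.under (𝓞 F) ∉ S} hadm
  have hμunr' : ∀ w : HeightOneSpectrum (𝓞 E), w.under (𝓞 F) ∉ S → μ.IsUnramifiedAt w :=
    fun w hw => hμunr w hw
  -- W3: the twisted datum
  obtain ⟨P', hSA', -⟩ := stub_twistAsaiDatum F E c h2 hc hE P₁ μ S A₁ hSA₁ hμunr'
  -- W5: unitary a.e.
  have hu := stub_unitaryAE F E c h2 hc hE P₁ P' μ χ₁ S A₁ hSA₁ hχ₁u hμres hμu hμunr' hcent₁ hSA'
  -- W6: the analytic package for `P'`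
  obtain ⟨σ₀, hσ₀, hmul, δ, hδ, hG⟩ := stub_holTwisted F E c h2 hc hE P' hu S _ hSA' hGS
  -- W4 + W1: untwisted factors of `μ(ϖ) • A₁` = `χ₁`-twisted factors of `A₁` = `χ`-twisted factors of `A`
  have hfac : ∀ (θ : ℤˣ) (v : HeightOneSpectrum (𝓞 F)), v ∉ S → ∀ x : ℂ,
      (asaiLocalPolynomial c (fun w => (A₁ w).map (μ.valueAtUniformizer w * ·)) θ (placeAbove E v)).eval x =
        (asaiLocalPolynomial c A θ (placeAbove E v)).eval (χ.valueAtUniformizer v * x) := by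
    intro θ v hv x
    rw [stub_twistedFactors F E c h2 hc hE P₁ μ χ₁ S A₁ hSA₁ hμres hμunr' θ v hv x, hfac₁ θ v hv x]
  refine ⟨σ₀, hσ₀, fun θ s hs => ?_, δ, hδ, fun θ => ?_⟩
  · have hm := hmul θ s hs
    have heq : (fun v : {v : HeightOneSpectrum (𝓞 F) // v ∉ S} =>
        ((asaiLocalPolynomial c (fun w => (A₁ w).map (μ.valueAtUniformizer w * ·)) θ (placeAbove E v.1)).eval
          ((v.1.residueCard : ℂ) ^ (-s)))⁻¹) =
        fun v : {v : HeightOneSpectrum (𝓞 F) // v ∉ S} =>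
          ((asaiLocalPolynomial c A θ (placeAbove E v.1)).eval
            (χ.valueAtUniformizer v.1 * (v.1.residueCard : ℂ) ^ (-s)))⁻¹ := by
      funext v
      rw [hfac θ v.1 v.2]
    rwa [heq] at hm
  · obtain ⟨G, hGd, hGeq⟩ := hG θ
    refine ⟨G, hGd, fun s hs => ?_⟩
    rw [hGeq s hs]
    congr 1
    unfold partialAsaiL partialAsaiLTwist
    exact tprod_congr fun v => by rw [hfac θ v.1 v.2]

/-- **Corollary: the line's bespoke named fact is implied by the canonical one** — a restatement of
`stub_flickerOfHolomorphy` under the name consumers search for. [cite: Flicker1988, Theorem p. 297 and p. 296]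
[cite: GrbacShahidi2015, Thm. 4.3 (1), (2)(a)] -/
theorem Flicker1988_twistedAsaiL_continuation_GL2_of_GrbacShahidi
    (hGS : GrbacShahidi2015_partialAsaiL_holomorphy) : Flicker1988_twistedAsaiL_continuation_GL2 :=
  stub_flickerOfHolomorphy hGS

end Summit.Langlands.Langlands.Theorems.QuadraticDescentGL2.Sketch

end
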